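import Literature.MathematicalPhysics.KineticTheory.HardSphereEulerProofs
import Literature.Probability.Divergences.FDivVariational
import Summits.AtomisticToContinuum.HydrodynamicLimit.Theorems.OneFlightGossipEngineEnergyCurrentTailsLevelCensusStatics
import Summits.AtomisticToContinuum.HydrodynamicLimit.Theorems.KineticFluxLdDecay.Negative.TiltBasics
import HarnessLib

/-!
# One-body entropy ledger — preliminaries A: Gaussian Pythagoras for the relative entropy
# (helper file of stub `stub_oneBodyLedger_of_static`, line `local-gibbs-entropy-ledger`,
# crux `KineticCurrentsWindowLDUniform`, stmt-AtomisticToContinuum-14662)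

The registered helper stub `stub_oneBodyLedger_of_static_pythagoras` (proved at the end of this
file): if a probability measure `μ` on `ℝ³` has finite entropy relative to SOME isotropic Maxwellian
`N(u, θ id) = gaussMeasure u θ` (`θ > 0`), then

* `‖v‖²` is `μ`-integrable (entropy inequality `∫⁻ g dμ ≤ KL(μ‖N) + ∫⁻ (e^g - 1) dN`,
  `obl_lintegral_ofReal_le_klDiv_add`, against a Gaussian exponential moment `e^{a‖v‖²}` supplied by
  Fernique's theorem for the standard Gaussian, `obl_integrable_exp_sq_gaussMeasure`);
* its kinetic temperature `e = (1/3) ∫ ‖v - m‖² dμ` (`m = ∫ v dμ`) is positive (`μ ≪` Lebesgue is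
  not a Dirac mass, `obl_temperature_pos`) and `∫ ‖v‖² dμ = 3e + ‖m‖²` (parallel axis,
  `obl_integral_norm_sub_sq`);
* **Gaussian Pythagoras**: for every `u'`, `θ' > 0`,
  `KL(μ ‖ N(u',θ')) = KL(μ ‖ N(m,e)) + ‖m - u'‖²/(2θ') + (3/2)(e/θ' - 1 - log(e/θ'))` in `ℝ≥0∞`.
  The log-likelihood ratios against two Maxwellians differ by the explicit quadratic
  `log M_{1,θ,u} - log M_{1,θ',u'}` (`obl_llr_gaussMeasure`, from `N(u,θ) = M_{1,θ,u} dv`,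
  `withDensity_localMaxwellian_eq_gaussMeasure`, and `Measure.rnDeriv_withDensity_right`), whose
  `μ`-mean is computed from `m, e` (`obl_toReal_klDiv_gaussMeasure_eq_add`). In particular the
  infimum of `KL(μ ‖ N(u,θ))` over all Maxwellians is attained at the moment-matched one.

All statements are folklore (Csiszár's Pythagorean identity for exponential families, Gaussian case);
`log M_{1,θ,u}` and `‖u + √θ w‖² ≤ 2‖u‖² + 2θ‖w‖²` are reused from `KineticFluxLdDecayTilt` /
`EnergyCurrentTailsLevelCensus`.
-/

noncomputable section

open MeasureTheory Set Filter InformationTheory ProbabilityTheory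
open scoped ENNReal Topology

namespace Summit.AtomisticToContinuum.HydrodynamicLimit.Theorems.KineticCurrentsWindowLDUniformLocalGibbs

open Literature.Analysis.FluidPDE (localMaxwellian)
open Literature.MathematicalPhysics.KineticTheory (T3 V3 gaussMeasure localMaxwellian_pos
  localMaxwellian_nonneg continuous_localMaxwellian integral_localMaxwellian_smul
  withDensity_localMaxwellian_eq_gaussMeasure integral_gaussMeasure)

/-! ### Entropy inequality and Gaussian exponential moments -/

/-- **Entropy (Fenchel–Young) bound in `ℝ≥0∞`.** For finite measures `μ ≪ ν` and a measurable
`g ≥ 0`: `∫⁻ g dμ ≤ KL(μ‖ν) + ∫⁻ (e^g - 1) dν`, with no integrability hypotheses (integrate the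
pointwise inequality `r y ≤ klFun r + (e^y - 1)` against `ν`). [folklore] -/
theorem obl_lintegral_ofReal_le_klDiv_add {α : Type*} [MeasurableSpace α] {μ ν : Measure α}
    [IsFiniteMeasure μ] [IsFiniteMeasure ν] (hμν : μ ≪ ν) {g : α → ℝ} (hg : Measurable g)
    (hg0 : ∀ x, 0 ≤ g x) :
    ∫⁻ x, ENNReal.ofReal (g x) ∂μ ≤
      klDiv μ ν + ∫⁻ x, ENNReal.ofReal (Real.exp (g x) - 1) ∂ν := by
  rw [klDiv_eq_lintegral_klFun_of_ac hμν,
    ← lintegral_rnDeriv_mul hμν hg.ennreal_ofReal.aemeasurable,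
    ← lintegral_add_left (by fun_prop)]
  refine lintegral_mono_ae ?_
  filter_upwards [Measure.rnDeriv_lt_top μ ν] with x hx
  rw [← ENNReal.ofReal_toReal hx.ne, ← ENNReal.ofReal_mul ENNReal.toReal_nonneg,
    ENNReal.toReal_ofReal ENNReal.toReal_nonneg,
    ← ENNReal.ofReal_add (klFun_nonneg ENNReal.toReal_nonneg)
      (by linarith [Real.add_one_le_exp (g x), hg0 x])]
  exact ENNReal.ofReal_le_ofReal
    (Literature.Probability.Divergences.klFun_fenchelYoung ENNReal.toReal_nonneg _)

/-- A Gaussian exponential moment of the reference Maxwellians: there is `c > 0` (a Fernique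
constant of the standard Gaussian on `ℝ³`) such that `w ↦ e^{c‖w‖²}` is `γ`-integrable. [folklore] -/
theorem obl_exists_exp_sq_integrable :
    ∃ c : ℝ, 0 < c ∧ Integrable (fun w : V3 => Real.exp (c * ‖w‖ ^ 2)) (stdGaussian V3) :=
  IsGaussian.exists_integrable_exp_sq _

/-- Exponential square moments of `gaussMeasure u θ`: if `e^{c‖w‖²}` is `γ`-integrable and
`0 ≤ a`, `2 a θ ≤ c`, then `e^{a‖v‖²}` is `gaussMeasure u θ`-integrable with
`∫ e^{a‖v‖²} dN(u,θ) ≤ e^{2a‖u‖²} ∫ e^{c‖w‖²} dγ`. [folklore] -/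
theorem obl_integrable_exp_sq_gaussMeasure {c : ℝ}
    (hc : Integrable (fun w : V3 => Real.exp (c * ‖w‖ ^ 2)) (stdGaussian V3))
    {a θ : ℝ} (ha : 0 ≤ a) (hθ : 0 < θ) (haθ : 2 * a * θ ≤ c) (u : V3) :
    Integrable (fun v : V3 => Real.exp (a * ‖v‖ ^ 2)) (gaussMeasure u θ) ∧
      ∫ v, Real.exp (a * ‖v‖ ^ 2) ∂gaussMeasure u θ ≤
        Real.exp (2 * a * ‖u‖ ^ 2) * ∫ w, Real.exp (c * ‖w‖ ^ 2) ∂stdGaussian V3 := by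
  have hdom : ∀ w : V3, Real.exp (a * ‖u + Real.sqrt θ • w‖ ^ 2) ≤
      Real.exp (2 * a * ‖u‖ ^ 2) * Real.exp (c * ‖w‖ ^ 2) := fun w => by
    rw [← Real.exp_add]
    refine Real.exp_le_exp.2 ?_
    have h1 := mul_le_mul_of_nonneg_left (EnergyCurrentTailsLevelCensus.norm_add_sqrt_smul_sq_le u w hθ.le) ha
    have h2 : 2 * a * θ * ‖w‖ ^ 2 ≤ c * ‖w‖ ^ 2 :=
      mul_le_mul_of_nonneg_right haθ (sq_nonneg _)
    nlinarith
  have hmeas : AEStronglyMeasurable (fun v : V3 => Real.exp (a * ‖v‖ ^ 2)) (gaussMeasure u θ) :=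
    (by fun_prop : Continuous fun v : V3 => Real.exp (a * ‖v‖ ^ 2)).aestronglyMeasurable
  have hint' : Integrable (fun w : V3 => Real.exp (a * ‖u + Real.sqrt θ • w‖ ^ 2)) (stdGaussian V3) := by
    refine (hc.const_mul (Real.exp (2 * a * ‖u‖ ^ 2))).mono'
      (by fun_prop : Continuous fun w : V3 =>
        Real.exp (a * ‖u + Real.sqrt θ • w‖ ^ 2)).aestronglyMeasurable (ae_of_all _ fun w => ?_)
    rw [Real.norm_eq_abs, abs_of_pos (Real.exp_pos _)]
    exact hdom w
  constructor
  · rw [gaussMeasure]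
    refine (integrable_map_measure ?_ (by fun_prop)).2 hint'
    exact (by fun_prop : Continuous fun v : V3 => Real.exp (a * ‖v‖ ^ 2)).aestronglyMeasurable
  · rw [integral_gaussMeasure u hθ, ← integral_const_mul]
    exact integral_mono hint' (hc.const_mul _) hdom


/-- **Finite entropy relative to a Maxwellian forces finite second moments**: if
`KL(μ ‖ gaussMeasure u θ) < ∞` (`θ > 0`) then `‖v‖²` is `μ`-integrable (entropy inequality
against the Gaussian exponential moment `e^{a‖v‖²}`, `a = c/(2θ)`). [folklore] -/
theorem obl_integrable_norm_sq_of_klDiv_ne_top {μ : Measure V3} [IsFiniteMeasure μ] {u : V3}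
    {θ : ℝ} (hθ : 0 < θ) (h : klDiv μ (gaussMeasure u θ) ≠ ∞) :
    Integrable (fun v : V3 => ‖v‖ ^ 2) μ := by
  obtain ⟨c, hc, hci⟩ := obl_exists_exp_sq_integrable
  set a : ℝ := c / (2 * θ) with ha
  have ha0 : 0 < a := div_pos hc (by positivity)
  have haθ : 2 * a * θ ≤ c := by
    have : 2 * a * θ = c := by rw [ha]; field_simp
    exact this.le
  have hμN : μ ≪ gaussMeasure u θ := (klDiv_ne_top_iff.1 h).1
  obtain ⟨hexpi, -⟩ := obl_integrable_exp_sq_gaussMeasure hci ha0.le hθ haθ u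
  have hbound := obl_lintegral_ofReal_le_klDiv_add hμN
    (by fun_prop : Measurable fun v : V3 => a * ‖v‖ ^ 2) (fun v => by positivity)
  have hfin : ∫⁻ v, ENNReal.ofReal (a * ‖v‖ ^ 2) ∂μ ≠ ∞ := by
    refine ne_top_of_le_ne_top (ENNReal.add_ne_top.2 ⟨h, ?_⟩) hbound
    have hnn : 0 ≤ᵐ[gaussMeasure u θ] fun v : V3 => Real.exp (a * ‖v‖ ^ 2) - 1 :=
      ae_of_all _ fun v => show (0 : ℝ) ≤ Real.exp (a * ‖v‖ ^ 2) - 1 by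
        have : 0 ≤ a * ‖v‖ ^ 2 := by positivity
        linarith [Real.add_one_le_exp (a * ‖v‖ ^ 2)]
    have hI : Integrable (fun v : V3 => Real.exp (a * ‖v‖ ^ 2) - 1) (gaussMeasure u θ) :=
      hexpi.sub (integrable_const 1)
    rw [← ofReal_integral_eq_lintegral_ofReal hI hnn]
    exact ENNReal.ofReal_ne_top
  have hint : Integrable (fun v : V3 => a * ‖v‖ ^ 2) μ :=
    (lintegral_ofReal_ne_top_iff_integrable
      (by fun_prop : Measurable fun v : V3 => a * ‖v‖ ^ 2).aestronglyMeasurable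
      (ae_of_all _ fun v => by positivity)).1 hfin
  have h2 := hint.const_mul a⁻¹
  simp_rw [← mul_assoc, inv_mul_cancel₀ ha0.ne', one_mul] at h2
  exact h2

/-! ### Log-likelihood ratios against Maxwellians -/

/-- Two Maxwellians differ by an explicit quadratic exponential tilt:
`log M_{1,θ,u} - log M_{1,θ',u'} = (3/2) log(θ'/θ) - ‖v-u‖²/(2θ) + ‖v-u'‖²/(2θ')`. [folklore] -/
theorem obl_log_localMaxwellian_sub {θ θ' : ℝ} (hθ : 0 < θ) (hθ' : 0 < θ') (u u' v : V3) :
    Real.log (localMaxwellian 1 θ u v) - Real.log (localMaxwellian 1 θ' u' v) =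
      3 / 2 * Real.log (θ' / θ) - ‖v - u‖ ^ 2 / (2 * θ) + ‖v - u'‖ ^ 2 / (2 * θ') := by
  rw [KineticFluxLdDecayTilt.log_localMaxwellian hθ, KineticFluxLdDecayTilt.log_localMaxwellian hθ',
    Real.log_mul (by positivity) hθ.ne', Real.log_mul (by positivity) hθ'.ne',
    Real.log_div hθ'.ne' hθ.ne']
  ring

/-- `gaussMeasure u θ` has the everywhere positive Lebesgue density `M_{1,θ,u}`; in particular
Lebesgue measure is absolutely continuous with respect to it. [folklore] -/
theorem obl_volume_absolutelyContinuous_gaussMeasure {θ : ℝ} (hθ : 0 < θ) (u : V3) :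
    (volume : Measure V3) ≪ gaussMeasure u θ := by
  rw [← withDensity_localMaxwellian_eq_gaussMeasure hθ u]
  exact withDensity_absolutelyContinuous'
    (continuous_localMaxwellian 1 θ u).measurable.ennreal_ofReal.aemeasurable
    (ae_of_all _ fun v => (ENNReal.ofReal_pos.2 (localMaxwellian_pos one_pos hθ u v)).ne')

/-- **Log-likelihood ratio against a Maxwellian.** For `μ ≪ Lebesgue`:
`llr μ N(u,θ) = log (dμ/dv) - log M_{1,θ,u}` `μ`-a.e. [folklore] -/
theorem obl_llr_gaussMeasure {μ : Measure V3} [SigmaFinite μ] (hμ : μ ≪ (volume : Measure V3))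
    {θ : ℝ} (hθ : 0 < θ) (u : V3) :
    llr μ (gaussMeasure u θ) =ᵐ[μ] fun v =>
      Real.log (μ.rnDeriv volume v).toReal - Real.log (localMaxwellian 1 θ u v) := by
  have hfm : Measurable fun v : V3 => ENNReal.ofReal (localMaxwellian 1 θ u v) :=
    (continuous_localMaxwellian 1 θ u).measurable.ennreal_ofReal
  have h1 := Measure.rnDeriv_withDensity_right μ (volume : Measure V3) hfm.aemeasurable
    (ae_of_all _ fun v => (ENNReal.ofReal_pos.2 (localMaxwellian_pos one_pos hθ u v)).ne')
    (ae_of_all _ fun v => ENNReal.ofReal_ne_top)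
  rw [withDensity_localMaxwellian_eq_gaussMeasure hθ u] at h1
  have h2 : ∀ᵐ v ∂μ, 0 < μ.rnDeriv volume v := Measure.rnDeriv_pos hμ
  have h3 : ∀ᵐ v ∂μ, μ.rnDeriv volume v < ∞ := hμ.ae_le (Measure.rnDeriv_lt_top μ volume)
  filter_upwards [hμ.ae_le h1, h2, h3] with v hv hpos hlt
  have hM : 0 < localMaxwellian 1 θ u v := localMaxwellian_pos one_pos hθ u v
  have hr : 0 < (μ.rnDeriv volume v).toReal := ENNReal.toReal_pos hpos.ne' hlt.ne
  rw [llr, hv, ENNReal.toReal_mul, ENNReal.toReal_inv, ENNReal.toReal_ofReal hM.le,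
    Real.log_mul (inv_pos.2 hM).ne' hr.ne', Real.log_inv]
  ring

/-- Changing the reference Maxwellian shifts the log-likelihood ratio by the explicit quadratic
`log M_{1,θ,u} - log M_{1,θ',u'}` (`μ ≪ Lebesgue`). [folklore] -/
theorem obl_llr_gaussMeasure_eq_add {μ : Measure V3} [SigmaFinite μ] (hμ : μ ≪ (volume : Measure V3))
    {θ θ' : ℝ} (hθ : 0 < θ) (hθ' : 0 < θ') (u u' : V3) :
    llr μ (gaussMeasure u' θ') =ᵐ[μ] fun v => llr μ (gaussMeasure u θ) v +
      (3 / 2 * Real.log (θ' / θ) - ‖v - u‖ ^ 2 / (2 * θ) + ‖v - u'‖ ^ 2 / (2 * θ')) := by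
  filter_upwards [obl_llr_gaussMeasure hμ hθ u, obl_llr_gaussMeasure hμ hθ' u'] with v h1 h2
  rw [h1, h2, ← obl_log_localMaxwellian_sub hθ hθ' u u' v]
  ring

/-! ### Second moments: mean and kinetic temperature -/

/-- A probability measure with finite second moment has an integrable identity. [folklore] -/
theorem obl_integrable_id {μ : Measure V3} [IsFiniteMeasure μ]
    (h2 : Integrable (fun v : V3 => ‖v‖ ^ 2) μ) : Integrable (fun v : V3 => v) μ :=
  ((memLp_two_iff_integrable_sq_norm aestronglyMeasurable_id).2 h2).integrable one_le_two

/-- Shifted squares are integrable under a finite second moment. [folklore] -/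
theorem obl_integrable_norm_sub_sq {μ : Measure V3} [IsFiniteMeasure μ]
    (h2 : Integrable (fun v : V3 => ‖v‖ ^ 2) μ) (u : V3) :
    Integrable (fun v : V3 => ‖v - u‖ ^ 2) μ := by
  have hdom : Integrable (fun v : V3 => 2 * ‖v‖ ^ 2 + 2 * ‖u‖ ^ 2) μ :=
    (h2.const_mul 2).add (integrable_const (2 * ‖u‖ ^ 2))
  refine hdom.mono' (by fun_prop : Continuous fun v : V3 => ‖v - u‖ ^ 2).aestronglyMeasurable
    (ae_of_all _ fun v => ?_)
  rw [Real.norm_eq_abs, abs_of_nonneg (sq_nonneg _)]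
  have h1 : ‖v - u‖ ^ 2 ≤ (‖v‖ + ‖u‖) ^ 2 := pow_le_pow_left₀ (norm_nonneg _) (norm_sub_le v u) 2
  nlinarith [sq_nonneg (‖v‖ - ‖u‖)]

/-- **Parallel axis (König–Huygens).** With `m = ∫ v dμ` (probability `μ`, finite second
moment): `∫ ‖v - u‖² dμ = ∫ ‖v - m‖² dμ + ‖m - u‖²`. [folklore] -/
theorem obl_integral_norm_sub_sq {μ : Measure V3} [IsProbabilityMeasure μ]
    (h2 : Integrable (fun v : V3 => ‖v‖ ^ 2) μ) (u : V3) :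
    ∫ v, ‖v - u‖ ^ 2 ∂μ = ∫ v, ‖v - ∫ w, w ∂μ‖ ^ 2 ∂μ + ‖(∫ w, w ∂μ) - u‖ ^ 2 := by
  set m : V3 := ∫ w, w ∂μ with hm
  have hid := obl_integrable_id h2
  have hsub : Integrable (fun v : V3 => v - m) μ := hid.sub (integrable_const m)
  have hexp : ∀ v : V3, ‖v - u‖ ^ 2 = ‖v - m‖ ^ 2 + 2 * inner ℝ (m - u) (v - m) + ‖m - u‖ ^ 2 := by
    intro v
    have : v - u = (v - m) + (m - u) := by abel
    rw [this, norm_add_sq_real, real_inner_comm]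
  rw [show (fun v : V3 => ‖v - u‖ ^ 2) = fun v =>
      ‖v - m‖ ^ 2 + 2 * inner ℝ (m - u) (v - m) + ‖m - u‖ ^ 2 from funext hexp]
  have hA : Integrable (fun v : V3 => ‖v - m‖ ^ 2) μ := obl_integrable_norm_sub_sq h2 m
  have hB : Integrable (fun v : V3 => 2 * inner ℝ (m - u) (v - m)) μ :=
    (hsub.const_inner _).const_mul 2
  have hAB : Integrable (fun v : V3 => ‖v - m‖ ^ 2 + 2 * inner ℝ (m - u) (v - m)) μ := hA.add hB
  rw [integral_add hAB (integrable_const _), integral_add hA hB, integral_const_mul,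
    integral_inner hsub, integral_sub hid (integrable_const m), integral_const, probReal_univ,
    one_smul, ← hm, sub_self, inner_zero_right, mul_zero, add_zero, integral_const, probReal_univ,
    one_smul]

/-- A probability measure with a Lebesgue density is not concentrated at its mean: its kinetic
temperature `e = (1/3) ∫ ‖v - m‖² dμ` is positive. [folklore] -/
theorem obl_temperature_pos {μ : Measure V3} [IsProbabilityMeasure μ] (hμ : μ ≪ (volume : Measure V3))
    (h2 : Integrable (fun v : V3 => ‖v‖ ^ 2) μ) (m : V3) :
    0 < 1 / 3 * ∫ v, ‖v - m‖ ^ 2 ∂μ := by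
  have hint := obl_integrable_norm_sub_sq h2 m
  have hnn : 0 ≤ ∫ v, ‖v - m‖ ^ 2 ∂μ := integral_nonneg fun v => sq_nonneg _
  rcases hnn.eq_or_lt with h0 | hpos
  · exfalso
    have hae : (fun v : V3 => ‖v - m‖ ^ 2) =ᵐ[μ] 0 :=
      (integral_eq_zero_iff_of_nonneg (fun v => sq_nonneg _) hint).1 h0.symm
    have h1 : ∀ᵐ v ∂μ, v ∈ ({m} : Set V3) := by
      filter_upwards [hae] with v hv
      have h' : ‖v - m‖ ^ 2 = 0 := hv
      rwa [sq_eq_zero_iff, norm_eq_zero, sub_eq_zero] at h'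
    have h1' : μ {v | ¬ v ∈ ({m} : Set V3)} = 0 := ae_iff.1 h1
    have hm0 : μ {m} = 0 := hμ (measure_singleton m)
    have huniv : μ univ = 0 := by
      refine measure_mono_null (fun v _ => ?_) (measure_union_null hm0 h1')
      by_cases hv : v ∈ ({m} : Set V3)
      · exact Or.inl hv
      · exact Or.inr hv
    exact one_ne_zero (measure_univ.symm.trans huniv)
  · positivity

/-! ### Gaussian Pythagoras for the relative entropy -/

/-- **Change of reference Maxwellian.** For a probability `μ ≪ Lebesgue` on `ℝ³` with finite
second moment and `θ, θ' > 0`: if `KL(μ‖N(u,θ)) < ∞` then `KL(μ‖N(u',θ')) < ∞` and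
`KL(μ‖N(u',θ')) = KL(μ‖N(u,θ)) + (3/2) log(θ'/θ) - ∫‖v-u‖²dμ/(2θ) + ∫‖v-u'‖²dμ/(2θ')`
(the log-likelihood ratios differ by the quadratic tilt `log M_{1,θ,u} - log M_{1,θ',u'}`).
[folklore] -/
theorem obl_toReal_klDiv_gaussMeasure_eq_add {μ : Measure V3} [IsProbabilityMeasure μ]
    (hμ : μ ≪ (volume : Measure V3)) (h2 : Integrable (fun v : V3 => ‖v‖ ^ 2) μ)
    {θ θ' : ℝ} (hθ : 0 < θ) (hθ' : 0 < θ') (u u' : V3) (hfin : klDiv μ (gaussMeasure u θ) ≠ ∞) :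
    klDiv μ (gaussMeasure u' θ') ≠ ∞ ∧
      (klDiv μ (gaussMeasure u' θ')).toReal = (klDiv μ (gaussMeasure u θ)).toReal +
        (3 / 2 * Real.log (θ' / θ) - (∫ v, ‖v - u‖ ^ 2 ∂μ) / (2 * θ) +
          (∫ v, ‖v - u'‖ ^ 2 ∂μ) / (2 * θ')) := by
  have hac : μ ≪ gaussMeasure u θ := hμ.trans (obl_volume_absolutelyContinuous_gaussMeasure hθ u)
  have hac' : μ ≪ gaussMeasure u' θ' :=
    hμ.trans (obl_volume_absolutelyContinuous_gaussMeasure hθ' u')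
  have hint : Integrable (llr μ (gaussMeasure u θ)) μ := (klDiv_ne_top_iff.1 hfin).2
  have hq1 : Integrable (fun v : V3 => 3 / 2 * Real.log (θ' / θ) - ‖v - u‖ ^ 2 / (2 * θ)) μ :=
    (integrable_const _).sub ((obl_integrable_norm_sub_sq h2 u).div_const _)
  have hq2 : Integrable (fun v : V3 => ‖v - u'‖ ^ 2 / (2 * θ')) μ :=
    (obl_integrable_norm_sub_sq h2 u').div_const _
  have hq : Integrable (fun v : V3 => 3 / 2 * Real.log (θ' / θ) - ‖v - u‖ ^ 2 / (2 * θ) +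
      ‖v - u'‖ ^ 2 / (2 * θ')) μ := hq1.add hq2
  have hae := obl_llr_gaussMeasure_eq_add hμ hθ hθ' u u'
  have hint' : Integrable (llr μ (gaussMeasure u' θ')) μ := by
    rw [integrable_congr hae]
    exact hint.add hq
  refine ⟨klDiv_ne_top hac' hint', ?_⟩
  rw [toReal_klDiv_of_measure_eq hac' (by simp), toReal_klDiv_of_measure_eq hac (by simp),
    integral_congr_ae hae, integral_add hint hq, integral_add hq1 hq2,
    integral_sub (integrable_const _) ((obl_integrable_norm_sub_sq h2 u).div_const _),
    integral_const, probReal_univ, one_smul, integral_div, integral_div]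

/-- The hydrodynamic entropy `‖m - u‖²/(2θ) + (3/2)(e/θ - 1 - log(e/θ))` is nonnegative
(`x - 1 - log x ≥ 0`). [folklore] -/
theorem obl_hydroEntropy_nonneg (m u : V3) {e θ : ℝ} (he : 0 < e) (hθ : 0 < θ) :
    0 ≤ ‖m - u‖ ^ 2 / (2 * θ) + 3 / 2 * (e / θ - 1 - Real.log (e / θ)) := by
  have h1 : Real.log (e / θ) ≤ e / θ - 1 := Real.log_le_sub_one_of_pos (div_pos he hθ)
  have h2 : 0 ≤ ‖m - u‖ ^ 2 / (2 * θ) := by positivity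
  nlinarith

/-- **Registered helper stub `stub_oneBodyLedger_of_static_pythagoras`** (helper file of S2
`stub_oneBodyLedger_of_static`, line `local-gibbs-entropy-ledger`, crux
stmt-AtomisticToContinuum-14662): **Gaussian Pythagoras for the relative entropy on `ℝ³`.** If a
probability measure `μ` has finite entropy relative to SOME Maxwellian `N(u, θ id)` (`θ > 0`),
then it has a finite second moment, its kinetic temperature `e = (1/3)∫‖v - m‖² dμ` (`m` its
mean) is positive, `∫ ‖v‖² dμ = 3e + ‖m‖²`, and for EVERY Maxwellian
`KL(μ ‖ N(u',θ')) = KL(μ ‖ N(m,e)) + ‖m-u'‖²/(2θ') + (3/2)(e/θ' - 1 - log(e/θ'))` in `ℝ≥0∞`: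
the entropy splits into a kinetic part (against the moment-matched Maxwellian, where the infimum
over Maxwellians is attained) plus the Gaussian relative entropy `KL(N(m,e) ‖ N(u',θ'))`.
[folklore] -/
theorem stub_oneBodyLedger_of_static_pythagoras :
    ∀ (μ : Measure V3) [IsProbabilityMeasure μ] (u : V3) (θ : ℝ), 0 < θ →
      klDiv μ (gaussMeasure u θ) ≠ ⊤ → ∀ (m : V3) (e : ℝ), m = ∫ v, v ∂μ →
      e = 1 / 3 * ∫ v, ‖v - m‖ ^ 2 ∂μ →
      Integrable (fun v : V3 => ‖v‖ ^ 2) μ ∧ 0 < e ∧ ∫ v, ‖v‖ ^ 2 ∂μ = 3 * e + ‖m‖ ^ 2 ∧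
      ∀ (u' : V3) (θ' : ℝ), 0 < θ' →
        klDiv μ (gaussMeasure u' θ') = klDiv μ (gaussMeasure m e) +
          ENNReal.ofReal (‖m - u'‖ ^ 2 / (2 * θ') + 3 / 2 * (e / θ' - 1 - Real.log (e / θ'))) := by
  intro μ _ u θ hθ hfin m e hm he
  have hac : μ ≪ gaussMeasure u θ := (klDiv_ne_top_iff.1 hfin).1
  have hμ : μ ≪ (volume : Measure V3) := by
    refine hac.trans ?_
    rw [← withDensity_localMaxwellian_eq_gaussMeasure hθ u]
    exact withDensity_absolutelyContinuous _ _
  have h2 := obl_integrable_norm_sq_of_klDiv_ne_top hθ hfin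
  have he0 : 0 < e := he ▸ obl_temperature_pos hμ h2 m
  have hvm : ∫ v, ‖v - m‖ ^ 2 ∂μ = 3 * e := by rw [he]; ring
  have hvu : ∀ u' : V3, ∫ v, ‖v - u'‖ ^ 2 ∂μ = 3 * e + ‖m - u'‖ ^ 2 := fun u' => by
    rw [obl_integral_norm_sub_sq h2 u', ← hm, hvm]
  have hE : ∫ v, ‖v‖ ^ 2 ∂μ = 3 * e + ‖m‖ ^ 2 := by simpa using hvu 0
  refine ⟨h2, he0, hE, fun u' θ' hθ' => ?_⟩
  obtain ⟨hfin_me, -⟩ := obl_toReal_klDiv_gaussMeasure_eq_add hμ h2 hθ he0 u m hfin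
  obtain ⟨hfin', h'⟩ := obl_toReal_klDiv_gaussMeasure_eq_add hμ h2 he0 hθ' m u' hfin_me
  have hlog : Real.log (θ' / e) = -Real.log (e / θ') := by rw [← Real.log_inv, inv_div]
  have he' : e ≠ 0 := he0.ne'
  have hθ'' : θ' ≠ 0 := hθ'.ne'
  rw [← ENNReal.ofReal_toReal hfin', ← ENNReal.ofReal_toReal hfin_me,
    ← ENNReal.ofReal_add ENNReal.toReal_nonneg (obl_hydroEntropy_nonneg m u' he0 hθ'), h', hvm, hvu,
    hlog]
  congr 1
  field_simp
  ring

end Summit.AtomisticToContinuum.HydrodynamicLimit.Theorems.KineticCurrentsWindowLDUniformLocalGibbs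

end
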